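import Mathlib
import HarnessLib

/-!
# Obsessional cliques: the untyped relational space of Laurent–Tortora de Falco

The semantic half of Laurent–Tortora de Falco, *Obsessional cliques: a semantic characterization
of bounded time complexity* (LICS 2006), §5 — everything that lives in the space `D` of points and
does not mention proof nets:

* `PrePoint` — the grammar `x ::= 1 | ⊥ | x ⊗ x | x ⅋ x | !μ | ?μ` of §5.1 with the finite multisets
  `μ` presented as lists; `Point` — the space `D` itself, the quotient of `PrePoint` identifying two
  pre-points iff they are equal as nested finite multisets (`Point.mk_ofCourse_eq_mk_ofCourse_iff`);
* `PrePoint.dual` / `Point.dual` — the duality `x ↦ x̄` (§5.1);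
* `PrePoint.act t k` / `Point.act t k` — the `t`-action `(k, x) ↦ (x)ₜ⁽ᵏ⁾` of the monoid `(ℕ*, ·)`
  (Def. 13), with the `ℕ`-set laws of Def. 1 PROVED (`Point.act_one`, `Point.act_mul`);
* `IsObsessional t c`, `ObsessionalFrom t c`, `ObsessionalClique t` — `t`-obsessional cliques and
  cliques obsessional from `t` (Def. 3, Def. 13), the obsessional hull (an orbit, by the monoid law),
  and the untyped form of the remark of §2.2 that dereliction is obsessional exactly for `t ≥ 1`;
* `PrePoint.IsHPoint h` — `h`-points (Def. 14) and their stability under the `h`-actions used in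
  the proof of Thm. 4; `PrePoint.qtree` — the `?`-tree sizes `T(x)` (Def. 15) and **Lemma 2**
  (action on `?`-trees), PROVED (`PrePoint.qtree_act`), with the two arithmetic corollaries used in
  the proof of Thm. 4 (divisibility by `h` at `t = 0`, and the bound `h · B`).

## Design notes

* Everything lives in the sub-namespace `URel` ("untyped relational model") of the topic namespace
  `Literature.Computability.ImplicitComplexity`, so that the short names `Point`, `PrePoint`,
  `IsObsessional`, … do not collide with other implicit-complexity files.
* Lean's kernel accepts the nested inductive `PrePoint` (nesting through `List`) but not a nesting
  through the quotient `Multiset`; hence the two-level presentation. All recursive definitions are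
  structural (mutual with an auxiliary function on `List PrePoint`, immediately characterised through
  `List.map`). The identification is the kernel of the canonical code `PrePoint.code : PrePoint → ℕ`,
  which encodes the `!`/`?` payload as a `Multiset ℕ` of codes; the lemmas `*_equiv_iff` show that
  it is exactly "same constructor, sub-points identified, in the `!`/`?` case as multisets".
  `Point` is countable with decidable equality.
* The action is defined for every `k : ℕ`; the paper only uses `k ∈ ℕ* = {1, 2, …}` and so do the
  clique-level definitions (`0 < k`). The monoid law `act_mul` holds for all naturals.
* `IsHPoint` and `qtree` are kept on `PrePoint` (they are computed on results of experiments, which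
  are concrete pre-points); both are invariant under the identification, but that is not needed here.

## Not in this file

Nets, `uELL`/`uSLL`, experiments and the interpretation `⟦R⟧` (Def. 5–12), hence Thm. 3
(invariance of `⟦R⟧` under cut elimination), Prop. 8 (obsessional cliques model `uELL`/`uSLL`),
Lemma 1, Lemma 3 and Thm. 4 (relative completeness): they quantify over proof nets, whose syntax is a
separate definition request (`SoftRepresentsAtLevel`). The typed categories `NREL`, `OREL`, `SREL`
of §2 are not formalised either.

## References

* O. Laurent, L. Tortora de Falco, *Obsessional cliques: a semantic characterization of bounded time
  complexity*, LICS 2006, 179–188, doi:10.1109/lics.2006.37 — §2.2 (Def. 1–3), §5.1 (the space `D`,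
  Def. 12–13), §5.3 (Def. 14–15, Lemma 2, Thm. 4), App. D (proof of Lemma 2).
-/

namespace Literature.Computability.ImplicitComplexity.URel

/-! ### Pre-points -/

/-- Pre-points: the grammar `x ::= 1 | ⊥ | x ⊗ x | x ⅋ x | !μ | ?μ` of the untyped relational space,
with each finite multiset `μ = [x₁, …, xₙ]` presented as a list. The space `D` of points is the
quotient `Point` below. [cite: LaurentTortoraDeFalco2006, §5.1] -/
inductive PrePoint : Type
  /-- the point `1` -/
  | one : PrePoint
  /-- the point `⊥` -/
  | bot : PrePoint
  /-- `x ⊗ y` -/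
  | tensor : PrePoint → PrePoint → PrePoint
  /-- `x ⅋ y` -/
  | par : PrePoint → PrePoint → PrePoint
  /-- `![x₁, …, xₙ]` -/
  | ofCourse : List PrePoint → PrePoint
  /-- `?[x₁, …, xₙ]` -/
  | whyNot : List PrePoint → PrePoint

namespace PrePoint

section ListHelpers

variable {α β : Type*}

/-- `scale k l`: every entry of `l` repeated `k` times — the list presentation of the multiset
`[k·a₁, …, k·aₙ]` appearing in the actions of Def. 1 and Def. 13.
[cite: LaurentTortoraDeFalco2006, Def. 1] -/
def scale (k : ℕ) (l : List α) : List α :=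
  l.flatMap fun a => List.replicate k a

/-- `scale` of the empty list. [cite: LaurentTortoraDeFalco2006, Def. 1] -/
@[simp] theorem scale_nil (k : ℕ) : scale k ([] : List α) = [] := rfl

/-- `scale` of a cons. [cite: LaurentTortoraDeFalco2006, Def. 1] -/
@[simp] theorem scale_cons (k : ℕ) (a : α) (l : List α) :
    scale k (a :: l) = List.replicate k a ++ scale k l := rfl

/-- `scale` is a monoid morphism for `++`. [cite: LaurentTortoraDeFalco2006, Def. 1] -/
theorem scale_append (k : ℕ) (l l' : List α) : scale k (l ++ l') = scale k l ++ scale k l' := by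
  simp [scale, List.flatMap_append]

/-- `scale k` multiplies the length by `k`. [cite: LaurentTortoraDeFalco2006, Def. 1] -/
@[simp] theorem length_scale (k : ℕ) (l : List α) : (scale k l).length = k * l.length := by
  induction l with
  | nil => simp
  | cons a l ih => simp [ih, Nat.mul_succ, Nat.add_comm]

/-- `scale 1` is the identity. [cite: LaurentTortoraDeFalco2006, Def. 1] -/
@[simp] theorem scale_one (l : List α) : scale 1 l = l := by
  induction l with
  | nil => rfl
  | cons a l ih => simp [ih]

/-- `scale 0` erases everything. [cite: LaurentTortoraDeFalco2006, Def. 1] -/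
@[simp] theorem scale_zero (l : List α) : scale 0 l = [] := by
  induction l with
  | nil => rfl
  | cons a l ih => simp [ih]

/-- `scale` commutes with `List.map`. [cite: LaurentTortoraDeFalco2006, Def. 1] -/
theorem map_scale (f : α → β) (k : ℕ) (l : List α) : (scale k l).map f = scale k (l.map f) := by
  induction l with
  | nil => rfl
  | cons a l ih => simp [ih]

/-- `scale` of a constant list. [cite: LaurentTortoraDeFalco2006, Def. 1] -/
theorem scale_replicate (k k' : ℕ) (a : α) :
    scale k' (List.replicate k a) = List.replicate (k * k') a := by
  induction k with
  | zero => simp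
  | succ k ih =>
      rw [List.replicate_succ, scale_cons, ih, List.replicate_append_replicate]
      congr 1
      ring

/-- Iterated scaling multiplies the factors (the computation behind the monoid law of Def. 1).
[cite: LaurentTortoraDeFalco2006, Def. 1] -/
theorem scale_scale (k k' : ℕ) (l : List α) : scale k' (scale k l) = scale (k * k') l := by
  induction l with
  | nil => rfl
  | cons a l ih => rw [scale_cons, scale_append, ih, scale_replicate, scale_cons]

/-- Membership in a scaled list. [cite: LaurentTortoraDeFalco2006, Def. 1] -/
theorem mem_scale {k : ℕ} {a : α} {l : List α} : a ∈ scale k l ↔ k ≠ 0 ∧ a ∈ l := by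
  simp only [scale, List.mem_flatMap, List.mem_replicate]
  constructor
  · rintro ⟨b, hb, hk, rfl⟩
    exact ⟨hk, hb⟩
  · rintro ⟨hk, ha⟩
    exact ⟨a, ha, hk, rfl⟩

/-- As a multiset, `scale k l` is `k • l`: the multiset `[k·a₁, …, k·aₙ]`.
[cite: LaurentTortoraDeFalco2006, Def. 1] -/
theorem coe_scale (k : ℕ) (l : List α) : (scale k l : Multiset α) = k • (l : Multiset α) := by
  induction l with
  | nil => simp
  | cons a l ih =>
      rw [scale_cons, ← Multiset.coe_add, ih, ← Multiset.cons_coe, Multiset.nsmul_cons,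
        Multiset.nsmul_singleton, Multiset.coe_replicate]

/-- `scale` respects permutations. [cite: LaurentTortoraDeFalco2006, Def. 1] -/
theorem perm_scale {k : ℕ} {l l' : List α} (h : l.Perm l') : (scale k l).Perm (scale k l') := by
  rw [← Multiset.coe_eq_coe, coe_scale, coe_scale, Multiset.coe_eq_coe.2 h]

/-- `bump t k l`: the exponential clause of the `t`-action of Def. 13 on the list of entries of a
`!`/`?` multiset — unchanged if it has at most `t` entries, every multiplicity multiplied by `k`
otherwise. [cite: LaurentTortoraDeFalco2006, Def. 13] -/
def bump (t k : ℕ) (l : List α) : List α :=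
  if l.length ≤ t then l else scale k l

/-- Small multisets are unchanged. [cite: LaurentTortoraDeFalco2006, Def. 13] -/
theorem bump_of_le {t k : ℕ} {l : List α} (h : l.length ≤ t) : bump t k l = l := if_pos h

/-- Large multisets are scaled. [cite: LaurentTortoraDeFalco2006, Def. 13] -/
theorem bump_of_lt {t k : ℕ} {l : List α} (h : t < l.length) : bump t k l = scale k l :=
  if_neg (Nat.not_le.2 h)

/-- The size of a bumped multiset. [cite: LaurentTortoraDeFalco2006, Def. 13] -/
theorem length_bump (t k : ℕ) (l : List α) :
    (bump t k l).length = if l.length ≤ t then l.length else k * l.length := by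
  unfold bump
  split_ifs <;> simp

/-- Bumping with factor `1` does nothing. [cite: LaurentTortoraDeFalco2006, Def. 13] -/
@[simp] theorem bump_one (t : ℕ) (l : List α) : bump t 1 l = l := by
  unfold bump
  split_ifs <;> simp

/-- `bump` commutes with `List.map`. [cite: LaurentTortoraDeFalco2006, Def. 13] -/
theorem map_bump (f : α → β) (t k : ℕ) (l : List α) : (bump t k l).map f = bump t k (l.map f) := by
  unfold bump
  simp only [List.length_map]
  split_ifs <;> simp [map_scale]

/-- Membership in a bumped list, positive factor. [cite: LaurentTortoraDeFalco2006, Def. 13] -/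
theorem mem_bump {t k : ℕ} {a : α} {l : List α} (hk : k ≠ 0) : a ∈ bump t k l ↔ a ∈ l := by
  unfold bump
  split_ifs <;> simp [mem_scale, hk]

/-- Entries of a bumped list are entries of the list. [cite: LaurentTortoraDeFalco2006, Def. 13] -/
theorem mem_of_mem_bump {t k : ℕ} {a : α} {l : List α} (h : a ∈ bump t k l) : a ∈ l := by
  unfold bump at h
  split_ifs at h
  · exact h
  · exact (mem_scale.1 h).2

/-- Iterated bumping multiplies the factors (the list-level monoid law behind `act_mul`).
[cite: LaurentTortoraDeFalco2006, Def. 1] -/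
theorem bump_bump (t k k' : ℕ) (l : List α) : bump t k' (bump t k l) = bump t (k * k') l := by
  by_cases h : l.length ≤ t
  · simp [bump, h]
  · rcases Nat.eq_zero_or_pos k with rfl | hk
    · simp [bump, h]
    · have h' : ¬ k * l.length ≤ t := fun h' => h (le_trans (Nat.le_mul_of_pos_left _ hk) h')
      simp [bump, h, h', scale_scale]

/-- As a multiset, `bump t k l` is `l` or `k • l`. [cite: LaurentTortoraDeFalco2006, Def. 13] -/
theorem coe_bump (t k : ℕ) (l : List α) :
    (bump t k l : Multiset α) = if l.length ≤ t then (l : Multiset α) else k • (l : Multiset α) := by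
  unfold bump
  split_ifs <;> simp [coe_scale]

/-- `bump` respects permutations. [cite: LaurentTortoraDeFalco2006, Def. 13] -/
theorem perm_bump {t k : ℕ} {l l' : List α} (h : l.Perm l') : (bump t k l).Perm (bump t k l') := by
  rw [← Multiset.coe_eq_coe, coe_bump, coe_bump, h.length_eq, Multiset.coe_eq_coe.2 h]

/-- If two lists have the same image multiset under `f`, and `g` is constant on the fibres of `f`
(across the two lists), then they have the same image multiset under `g`. The combinatorial step
that lifts congruence lemmas through the `!`/`?` constructors. [folklore] -/
theorem perm_map_of_perm_map {γ : Type*} {f : α → β} {g : α → γ} :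
    ∀ {l₁ l₂ : List α}, (l₁.map f).Perm (l₂.map f) →
      (∀ a ∈ l₁, ∀ b ∈ l₂, f a = f b → g a = g b) → (l₁.map g).Perm (l₂.map g)
  | [], l₂, h, _ => by
      have h₂ : l₂ = [] := by simpa using h.symm.eq_nil
      subst h₂
      exact List.Perm.refl _
  | a :: l₁, l₂, h, hg => by
      have ha : f a ∈ l₂.map f := h.subset (by simp)
      obtain ⟨b, hb, hfb⟩ := List.mem_map.1 ha
      obtain ⟨s, r, rfl⟩ := List.append_of_mem hb
      have hperm : (s ++ b :: r).Perm (b :: (s ++ r)) := List.perm_middle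
      have h' : (l₁.map f).Perm ((s ++ r).map f) := by
        have h₁ := h.trans (hperm.map f)
        rw [List.map_cons, List.map_cons, hfb] at h₁
        exact h₁.cons_inv
      have hsub : ∀ b' ∈ s ++ r, b' ∈ s ++ b :: r := fun b' hb' => by
        simp only [List.mem_append, List.mem_cons] at hb' ⊢
        tauto
      have ih := perm_map_of_perm_map h'
        (fun a' ha' b' hb' => hg a' (List.mem_cons_of_mem _ ha') b' (hsub b' hb'))
      have hgab : g a = g b := hg a (by simp) b hb hfb.symm
      have h3 : (g b :: (s ++ r).map g).Perm ((s ++ b :: r).map g) := by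
        simpa using (hperm.map g).symm
      rw [List.map_cons, hgab]
      exact (ih.cons _).trans h3

end ListHelpers

/-! ### Duality, the `t`-action, `h`-points, `?`-trees, canonical codes -/

mutual
/-- The dual `x̄` of a pre-point: `1̄ = ⊥`, `⊥̄ = 1`, `(x ⊗ y)‾ = x̄ ⅋ ȳ`, `(x ⅋ y)‾ = x̄ ⊗ ȳ`,
`(![x₁,…,xₙ])‾ = ?[x̄₁,…,x̄ₙ]`, `(?[x₁,…,xₙ])‾ = ![x̄₁,…,x̄ₙ]`. [cite: LaurentTortoraDeFalco2006, §5.1] -/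
def dual : PrePoint → PrePoint
  | one => bot
  | bot => one
  | tensor x y => par (dual x) (dual y)
  | par x y => tensor (dual x) (dual y)
  | ofCourse μ => whyNot (dualList μ)
  | whyNot μ => ofCourse (dualList μ)
/-- Entrywise dual of a list (auxiliary for structural recursion; equals `List.map dual`,
see `dualList_eq_map`). [cite: LaurentTortoraDeFalco2006, §5.1] -/
def dualList : List PrePoint → List PrePoint
  | [] => []
  | x :: μ => dual x :: dualList μ
end

/-- `dualList` is `List.map dual`. [cite: LaurentTortoraDeFalco2006, §5.1] -/
theorem dualList_eq_map (μ : List PrePoint) : dualList μ = μ.map dual := by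
  induction μ with
  | nil => rfl
  | cons x μ ih => simp [dualList, ih]

mutual
/-- The `t`-action `(k, x) ↦ (x)ₜ⁽ᵏ⁾` of `ℕ*` on pre-points (Def. 13): homomorphic on `1, ⊥, ⊗, ⅋`;
on `![x₁,…,xₙ]` and `?[x₁,…,xₙ]` it acts entrywise if `n ≤ t` and, if `n > t`, entrywise followed
by multiplying every multiplicity by `k`. Defined for every `k : ℕ` (the paper uses `k ≥ 1`).
[cite: LaurentTortoraDeFalco2006, Def. 13] -/
def act (t k : ℕ) : PrePoint → PrePoint
  | one => one
  | bot => bot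
  | tensor x y => tensor (act t k x) (act t k y)
  | par x y => par (act t k x) (act t k y)
  | ofCourse μ => ofCourse (bump t k (actList t k μ))
  | whyNot μ => whyNot (bump t k (actList t k μ))
/-- Entrywise action on a list (auxiliary for structural recursion; equals `List.map (act t k)`,
see `actList_eq_map`). [cite: LaurentTortoraDeFalco2006, Def. 13] -/
def actList (t k : ℕ) : List PrePoint → List PrePoint
  | [] => []
  | x :: μ => act t k x :: actList t k μ
end

/-- `actList` is `List.map (act t k)`. [cite: LaurentTortoraDeFalco2006, Def. 13] -/
theorem actList_eq_map (t k : ℕ) (μ : List PrePoint) : actList t k μ = μ.map (act t k) := by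
  induction μ with
  | nil => rfl
  | cons x μ ih => simp [actList, ih]

/-- The action preserves the number of entries of a list. [cite: LaurentTortoraDeFalco2006, Def. 13] -/
@[simp] theorem length_actList (t k : ℕ) (μ : List PrePoint) : (actList t k μ).length = μ.length := by
  rw [actList_eq_map, List.length_map]

/-- `actList` commutes with `bump`. [cite: LaurentTortoraDeFalco2006, Def. 13] -/
theorem actList_bump (t k t' k' : ℕ) (l : List PrePoint) :
    actList t k (bump t' k' l) = bump t' k' (actList t k l) := by
  rw [actList_eq_map, actList_eq_map, map_bump]

/-- `dualList` commutes with `bump`. [cite: LaurentTortoraDeFalco2006, Def. 13] -/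
theorem dualList_bump (t k : ℕ) (l : List PrePoint) :
    dualList (bump t k l) = bump t k (dualList l) := by
  rw [dualList_eq_map, dualList_eq_map, map_bump]

/-- Exponential-free (purely multiplicative) pre-points: no `!`/`?` anywhere. These are the points
of the `MLL` fragment, on which every action is trivial (`act_eq_self_of_isExpFree`), which is why
"for MLL any clique is obsessional" (§5.3). [cite: LaurentTortoraDeFalco2006, §5.3] -/
def IsExpFree : PrePoint → Prop
  | one => True
  | bot => True
  | tensor x y => IsExpFree x ∧ IsExpFree y
  | par x y => IsExpFree x ∧ IsExpFree y
  | ofCourse _ => False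
  | whyNot _ => False

mutual
/-- `h`-points (Def. 14): `1`, `⊥` are `h`-points; `x ⊗ y`, `x ⅋ y` are if `x, y` are;
`?[x₁,…,xₙ]` is if all `xᵢ` are; `![x₁,…,xₙ]` is if `n = h` and all `xᵢ` are.
[cite: LaurentTortoraDeFalco2006, Def. 14] -/
def IsHPoint (h : ℕ) : PrePoint → Prop
  | one => True
  | bot => True
  | tensor x y => IsHPoint h x ∧ IsHPoint h y
  | par x y => IsHPoint h x ∧ IsHPoint h y
  | ofCourse μ => μ.length = h ∧ AllHPoint h μ
  | whyNot μ => AllHPoint h μ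
/-- All entries of a list are `h`-points (auxiliary for structural recursion, see `allHPoint_iff`).
[cite: LaurentTortoraDeFalco2006, Def. 14] -/
def AllHPoint (h : ℕ) : List PrePoint → Prop
  | [] => True
  | x :: μ => IsHPoint h x ∧ AllHPoint h μ
end

/-- `AllHPoint h μ` says every entry of `μ` is an `h`-point. [cite: LaurentTortoraDeFalco2006, Def. 14] -/
theorem allHPoint_iff {h : ℕ} {μ : List PrePoint} : AllHPoint h μ ↔ ∀ x ∈ μ, IsHPoint h x := by
  induction μ with
  | nil => simp [AllHPoint]
  | cons x μ ih => simp [AllHPoint, ih]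

mutual
/-- The `?`-tree sizes `T(x) ⊆ ℕ` of a pre-point (Def. 15): `T(1) = T(⊥) = ∅`,
`T(x ⊗ y) = T(x ⅋ y) = T(x) ∪ T(y)`, `T(![x₁,…,xₙ]) = ⋃ T(xᵢ)`,
`T(?[x₁,…,xₙ]) = {n} ∪ ⋃ T(xᵢ)`. [cite: LaurentTortoraDeFalco2006, Def. 15] -/
def qtree : PrePoint → Finset ℕ
  | one => ∅
  | bot => ∅
  | tensor x y => qtree x ∪ qtree y
  | par x y => qtree x ∪ qtree y
  | ofCourse μ => qtreeList μ
  | whyNot μ => insert μ.length (qtreeList μ)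
/-- Union of the `?`-tree sizes of the entries of a list (auxiliary, see `mem_qtreeList`).
[cite: LaurentTortoraDeFalco2006, Def. 15] -/
def qtreeList : List PrePoint → Finset ℕ
  | [] => ∅
  | x :: μ => qtree x ∪ qtreeList μ
end

/-- Membership in `qtreeList`. [cite: LaurentTortoraDeFalco2006, Def. 15] -/
theorem mem_qtreeList {n : ℕ} {μ : List PrePoint} : n ∈ qtreeList μ ↔ ∃ x ∈ μ, n ∈ qtree x := by
  induction μ with
  | nil => simp [qtreeList]
  | cons x μ ih => simp [qtreeList, ih, or_and_right, exists_or]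

mutual
/-- Canonical code of a pre-point: a tag for the constructor paired with the codes of the
sub-points — for `!`/`?` with the code of the MULTISET of the codes of the entries, so that the
order of the entries is forgotten and nothing else. Its kernel is the identification defining
`Point`. [cite: LaurentTortoraDeFalco2006, §5.1] -/
def code : PrePoint → ℕ
  | one => Nat.pair 0 0
  | bot => Nat.pair 1 0
  | tensor x y => Nat.pair 2 (Nat.pair (code x) (code y))
  | par x y => Nat.pair 3 (Nat.pair (code x) (code y))
  | ofCourse μ => Nat.pair 4 (Encodable.encode (codeList μ : Multiset ℕ))
  | whyNot μ => Nat.pair 5 (Encodable.encode (codeList μ : Multiset ℕ))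
/-- Codes of the entries of a list (auxiliary, see `codeList_eq_map`).
[cite: LaurentTortoraDeFalco2006, §5.1] -/
def codeList : List PrePoint → List ℕ
  | [] => []
  | x :: μ => code x :: codeList μ
end

/-- `codeList` is `List.map code`. [cite: LaurentTortoraDeFalco2006, §5.1] -/
@[simp] theorem codeList_eq_map (μ : List PrePoint) : codeList μ = μ.map code := by
  induction μ with
  | nil => rfl
  | cons x μ ih => simp [codeList, ih]

/-! ### The identification: equality as nested multisets -/

/-- Two pre-points present the same point of `D` iff they have the same canonical code, i.e. iff
they are equal as nested finite multisets (see the lemmas `*_equiv_iff`).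
[cite: LaurentTortoraDeFalco2006, §5.1] -/
instance instSetoid : Setoid PrePoint where
  r x y := code x = code y
  iseqv := ⟨fun _ => rfl, fun h => h.symm, fun h₁ h₂ => h₁.trans h₂⟩

/-- Unfolding the identification. [cite: LaurentTortoraDeFalco2006, §5.1] -/
theorem equiv_def {x y : PrePoint} : x ≈ y ↔ code x = code y := Iff.rfl

/-- The identification is decidable. [cite: LaurentTortoraDeFalco2006, §5.1] -/
instance instDecidableEquiv : DecidableRel (α := PrePoint) (· ≈ ·) :=
  fun x y => inferInstanceAs (Decidable (code x = code y))

/-- `1` is identified only with itself. [cite: LaurentTortoraDeFalco2006, §5.1] -/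
@[simp] theorem one_equiv_iff {y : PrePoint} : one ≈ y ↔ y = one := by
  cases y <;> simp [code, Nat.pair_eq_pair]

/-- `⊥` is identified only with itself. [cite: LaurentTortoraDeFalco2006, §5.1] -/
@[simp] theorem bot_equiv_iff {y : PrePoint} : bot ≈ y ↔ y = bot := by
  cases y <;> simp [code, Nat.pair_eq_pair]

/-- `x₁ ⊗ x₂` is identified exactly with the `y₁ ⊗ y₂` with `xᵢ` identified with `yᵢ`.
[cite: LaurentTortoraDeFalco2006, §5.1] -/
theorem tensor_equiv_iff {x₁ x₂ y : PrePoint} :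
    tensor x₁ x₂ ≈ y ↔ ∃ y₁ y₂, y = tensor y₁ y₂ ∧ x₁ ≈ y₁ ∧ x₂ ≈ y₂ := by
  cases y <;> simp [code, Nat.pair_eq_pair]

/-- `x₁ ⅋ x₂` is identified exactly with the `y₁ ⅋ y₂` with `xᵢ` identified with `yᵢ`.
[cite: LaurentTortoraDeFalco2006, §5.1] -/
theorem par_equiv_iff {x₁ x₂ y : PrePoint} :
    par x₁ x₂ ≈ y ↔ ∃ y₁ y₂, y = par y₁ y₂ ∧ x₁ ≈ y₁ ∧ x₂ ≈ y₂ := by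
  cases y <;> simp [code, Nat.pair_eq_pair]

/-- `![x₁,…,xₙ]` is identified exactly with the `![y₁,…,yₘ]` whose entries have the same codes
AS A MULTISET (so `m = n` and the entries correspond up to order and identification).
[cite: LaurentTortoraDeFalco2006, §5.1] -/
theorem ofCourse_equiv_iff {μ : List PrePoint} {y : PrePoint} :
    ofCourse μ ≈ y ↔ ∃ ν, y = ofCourse ν ∧ (μ.map code).Perm (ν.map code) := by
  cases y <;> simp [code, Nat.pair_eq_pair]

/-- `?[x₁,…,xₙ]` is identified exactly with the `?[y₁,…,yₘ]` whose entries have the same codes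
as a multiset. [cite: LaurentTortoraDeFalco2006, §5.1] -/
theorem whyNot_equiv_iff {μ : List PrePoint} {y : PrePoint} :
    whyNot μ ≈ y ↔ ∃ ν, y = whyNot ν ∧ (μ.map code).Perm (ν.map code) := by
  cases y <;> simp [code, Nat.pair_eq_pair]

/-- `⊗` is a congruence. [cite: LaurentTortoraDeFalco2006, §5.1] -/
theorem tensor_congr {x₁ x₂ y₁ y₂ : PrePoint} (h₁ : x₁ ≈ y₁) (h₂ : x₂ ≈ y₂) :
    tensor x₁ x₂ ≈ tensor y₁ y₂ :=
  tensor_equiv_iff.2 ⟨_, _, rfl, h₁, h₂⟩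

/-- `⅋` is a congruence. [cite: LaurentTortoraDeFalco2006, §5.1] -/
theorem par_congr {x₁ x₂ y₁ y₂ : PrePoint} (h₁ : x₁ ≈ y₁) (h₂ : x₂ ≈ y₂) :
    par x₁ x₂ ≈ par y₁ y₂ :=
  par_equiv_iff.2 ⟨_, _, rfl, h₁, h₂⟩

/-- Permuting the entries of `!μ` does not change the point. [cite: LaurentTortoraDeFalco2006, §5.1] -/
theorem ofCourse_congr_perm {μ ν : List PrePoint} (h : μ.Perm ν) : ofCourse μ ≈ ofCourse ν :=
  ofCourse_equiv_iff.2 ⟨_, rfl, h.map _⟩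

/-- Permuting the entries of `?μ` does not change the point. [cite: LaurentTortoraDeFalco2006, §5.1] -/
theorem whyNot_congr_perm {μ ν : List PrePoint} (h : μ.Perm ν) : whyNot μ ≈ whyNot ν :=
  whyNot_equiv_iff.2 ⟨_, rfl, h.map _⟩

/-- Duality respects the identification. [cite: LaurentTortoraDeFalco2006, §5.1] -/
theorem dual_congr : ∀ {x y : PrePoint}, x ≈ y → dual x ≈ dual y := by
  intro x
  induction x using PrePoint.rec
    (motive_2 := fun μ => ∀ x ∈ μ, ∀ y, x ≈ y → dual x ≈ dual y) with
  | one => intro y h; rw [one_equiv_iff] at h; subst h; exact Setoid.refl _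
  | bot => intro y h; rw [bot_equiv_iff] at h; subst h; exact Setoid.refl _
  | tensor x₁ x₂ h₁ h₂ =>
      intro y h
      obtain ⟨y₁, y₂, rfl, e₁, e₂⟩ := tensor_equiv_iff.1 h
      simp only [dual]
      exact par_congr (h₁ e₁) (h₂ e₂)
  | par x₁ x₂ h₁ h₂ =>
      intro y h
      obtain ⟨y₁, y₂, rfl, e₁, e₂⟩ := par_equiv_iff.1 h
      simp only [dual]
      exact tensor_congr (h₁ e₁) (h₂ e₂)
  | ofCourse μ ih =>
      intro y h
      obtain ⟨ν, rfl, hp⟩ := ofCourse_equiv_iff.1 h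
      simp only [dual, dualList_eq_map]
      refine whyNot_equiv_iff.2 ⟨_, rfl, ?_⟩
      rw [List.map_map, List.map_map]
      exact perm_map_of_perm_map hp fun a ha b _ hab => ih a ha b hab
  | whyNot μ ih =>
      intro y h
      obtain ⟨ν, rfl, hp⟩ := whyNot_equiv_iff.1 h
      simp only [dual, dualList_eq_map]
      refine ofCourse_equiv_iff.2 ⟨_, rfl, ?_⟩
      rw [List.map_map, List.map_map]
      exact perm_map_of_perm_map hp fun a ha b _ hab => ih a ha b hab
  | nil => simp_all
  | cons x μ hx hμ =>
      rename_i x' hx' y hy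
      rcases List.mem_cons.1 hx' with rfl | h
      · exact hx hy
      · exact hμ x' h y hy

/-- The `t`-action respects the identification (it is well defined on `D`).
[cite: LaurentTortoraDeFalco2006, Def. 13] -/
theorem act_congr (t k : ℕ) : ∀ {x y : PrePoint}, x ≈ y → act t k x ≈ act t k y := by
  intro x
  induction x using PrePoint.rec
    (motive_2 := fun μ => ∀ x ∈ μ, ∀ y, x ≈ y → act t k x ≈ act t k y) with
  | one => intro y h; rw [one_equiv_iff] at h; subst h; exact Setoid.refl _
  | bot => intro y h; rw [bot_equiv_iff] at h; subst h; exact Setoid.refl _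
  | tensor x₁ x₂ h₁ h₂ =>
      intro y h
      obtain ⟨y₁, y₂, rfl, e₁, e₂⟩ := tensor_equiv_iff.1 h
      simp only [act]
      exact tensor_congr (h₁ e₁) (h₂ e₂)
  | par x₁ x₂ h₁ h₂ =>
      intro y h
      obtain ⟨y₁, y₂, rfl, e₁, e₂⟩ := par_equiv_iff.1 h
      simp only [act]
      exact par_congr (h₁ e₁) (h₂ e₂)
  | ofCourse μ ih =>
      intro y h
      obtain ⟨ν, rfl, hp⟩ := ofCourse_equiv_iff.1 h
      simp only [act]
      refine ofCourse_equiv_iff.2 ⟨_, rfl, ?_⟩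
      rw [map_bump, map_bump, actList_eq_map, actList_eq_map, List.map_map, List.map_map]
      exact perm_bump (perm_map_of_perm_map hp fun a ha b _ hab => ih a ha b hab)
  | whyNot μ ih =>
      intro y h
      obtain ⟨ν, rfl, hp⟩ := whyNot_equiv_iff.1 h
      simp only [act]
      refine whyNot_equiv_iff.2 ⟨_, rfl, ?_⟩
      rw [map_bump, map_bump, actList_eq_map, actList_eq_map, List.map_map, List.map_map]
      exact perm_bump (perm_map_of_perm_map hp fun a ha b _ hab => ih a ha b hab)
  | nil => simp_all
  | cons x μ hx hμ =>
      rename_i x' hx' y hy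
      rcases List.mem_cons.1 hx' with rfl | h
      · exact hx hy
      · exact hμ x' h y hy

/-! ### Laws of duality and of the action on pre-points -/

mutual
/-- Duality is an involution. [cite: LaurentTortoraDeFalco2006, §5.1] -/
theorem dual_dual : ∀ x : PrePoint, dual (dual x) = x
  | one => rfl
  | bot => rfl
  | tensor x y => by simp [dual, dual_dual x, dual_dual y]
  | par x y => by simp [dual, dual_dual x, dual_dual y]
  | ofCourse μ => by simp only [dual, dualList_dualList μ]
  | whyNot μ => by simp only [dual, dualList_dualList μ]
/-- Entrywise duality is an involution. [cite: LaurentTortoraDeFalco2006, §5.1] -/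
theorem dualList_dualList : ∀ μ : List PrePoint, dualList (dualList μ) = μ
  | [] => rfl
  | x :: μ => by simp only [dualList, dual_dual x, dualList_dualList μ]
end

/-- Def. 1, first law, for the `t`-action of Def. 13: `(x)ₜ⁽¹⁾ = x`.
[cite: LaurentTortoraDeFalco2006, Def. 1] -/
theorem act_one (t : ℕ) (x : PrePoint) : act t 1 x = x := by
  induction x using PrePoint.rec (motive_2 := fun μ => actList t 1 μ = μ) with
  | one => rfl
  | bot => rfl
  | tensor x y hx hy => simp [act, hx, hy]
  | par x y hx hy => simp [act, hx, hy]
  | ofCourse μ ih => simp [act, ih]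
  | whyNot μ ih => simp [act, ih]
  | nil => rfl
  | cons x μ hx hμ => simp [actList, hx, hμ]

/-- Def. 1, second law, for the `t`-action of Def. 13: `(x)ₜ⁽ᵏᵏ'⁾ = ((x)ₜ⁽ᵏ⁾)ₜ⁽ᵏ'⁾` — so Def. 13
is an action of the monoid `(ℕ*, ·)` (in fact of `(ℕ, ·)`). [cite: LaurentTortoraDeFalco2006, Def. 1] -/
theorem act_mul (t k k' : ℕ) (x : PrePoint) : act t (k * k') x = act t k' (act t k x) := by
  induction x using PrePoint.rec
    (motive_2 := fun μ => actList t (k * k') μ = actList t k' (actList t k μ)) with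
  | one => rfl
  | bot => rfl
  | tensor x y hx hy => simp [act, hx, hy]
  | par x y hx hy => simp [act, hx, hy]
  | ofCourse μ ih => simp [act, ih, actList_bump, bump_bump]
  | whyNot μ ih => simp [act, ih, actList_bump, bump_bump]
  | nil => rfl
  | cons x μ hx hμ => simp [actList, hx, hμ]

/-- The actions for different factors commute. [cite: LaurentTortoraDeFalco2006, Def. 1] -/
theorem act_comm (t k k' : ℕ) (x : PrePoint) : act t k' (act t k x) = act t k (act t k' x) := by
  rw [← act_mul, mul_comm, act_mul]

/-- The action commutes with duality. [cite: LaurentTortoraDeFalco2006, Def. 13] -/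
theorem dual_act (t k : ℕ) (x : PrePoint) : dual (act t k x) = act t k (dual x) := by
  induction x using PrePoint.rec
    (motive_2 := fun μ => dualList (actList t k μ) = actList t k (dualList μ)) with
  | one => rfl
  | bot => rfl
  | tensor x y hx hy => simp [act, dual, hx, hy]
  | par x y hx hy => simp [act, dual, hx, hy]
  | ofCourse μ ih => simp only [act, dual, dualList_bump, ih]
  | whyNot μ ih => simp only [act, dual, dualList_bump, ih]
  | nil => rfl
  | cons x μ hx hμ => simp only [actList, dualList, hx, hμ]

/-- Exponential-free pre-points are fixed by every action ("for MLL any clique is obsessional").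
[cite: LaurentTortoraDeFalco2006, §5.3] -/
theorem act_eq_self_of_isExpFree (t k : ℕ) : ∀ {x : PrePoint}, IsExpFree x → act t k x = x := by
  intro x
  induction x using PrePoint.rec (motive_2 := fun _ => True) with
  | one => intro; rfl
  | bot => intro; rfl
  | tensor x y hx hy => rintro ⟨h₁, h₂⟩; simp [act, hx h₁, hy h₂]
  | par x y hx hy => rintro ⟨h₁, h₂⟩; simp [act, hx h₁, hy h₂]
  | ofCourse μ _ => rintro ⟨⟩
  | whyNot μ _ => rintro ⟨⟩
  | nil => trivial
  | cons _ _ _ _ => trivial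

/-! ### `h`-points under the actions (used in the proof of Thm. 4) -/

/-- A `t`-point stays a `t`-point under the `t`-action ("since `x` is a `t`-point, `(x)ₜ⁽ʰ⁾` is also
a `t`-point", proof of Thm. 4). [cite: LaurentTortoraDeFalco2006, Thm. 4 (proof)] -/
theorem isHPoint_act_self {t : ℕ} (k : ℕ) : ∀ {x : PrePoint}, IsHPoint t x → IsHPoint t (act t k x) := by
  intro x
  induction x using PrePoint.rec
    (motive_2 := fun μ => AllHPoint t μ → AllHPoint t (actList t k μ)) with
  | one => intro; trivial
  | bot => intro; trivial
  | tensor x y hx hy => rintro ⟨h₁, h₂⟩; exact ⟨hx h₁, hy h₂⟩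
  | par x y hx hy => rintro ⟨h₁, h₂⟩; exact ⟨hx h₁, hy h₂⟩
  | ofCourse μ ih =>
      rintro ⟨hlen, hall⟩
      have hle : (actList t k μ).length ≤ t := by rw [length_actList, hlen]
      simp only [act, IsHPoint, bump_of_le hle, length_actList]
      exact ⟨hlen, ih hall⟩
  | whyNot μ ih =>
      intro hall
      simp only [act, IsHPoint]
      exact allHPoint_iff.2 fun y hy => allHPoint_iff.1 (ih hall) y (mem_of_mem_bump hy)
  | nil => simp [actList, AllHPoint]
  | cons x μ hx hμ =>
      rename_i hxμ
      simp only [actList, AllHPoint] at hxμ ⊢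
      exact ⟨hx hxμ.1, hμ hxμ.2⟩

/-- A `1`-point becomes an `h`-point under the `0`-action with factor `h` ("`(x)₀⁽ʰ⁾ ∈ ⟦R⟧`, which
is an `h`-point", proof of Thm. 4). [cite: LaurentTortoraDeFalco2006, Thm. 4 (proof)] -/
theorem isHPoint_act_zero (h : ℕ) : ∀ {x : PrePoint}, IsHPoint 1 x → IsHPoint h (act 0 h x) := by
  intro x
  induction x using PrePoint.rec
    (motive_2 := fun μ => AllHPoint 1 μ → AllHPoint h (actList 0 h μ)) with
  | one => intro; trivial
  | bot => intro; trivial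
  | tensor x y hx hy => rintro ⟨h₁, h₂⟩; exact ⟨hx h₁, hy h₂⟩
  | par x y hx hy => rintro ⟨h₁, h₂⟩; exact ⟨hx h₁, hy h₂⟩
  | ofCourse μ ih =>
      rintro ⟨hlen, hall⟩
      have hlt : 0 < (actList 0 h μ).length := by rw [length_actList, hlen]; exact Nat.one_pos
      simp only [act, IsHPoint, bump_of_lt hlt, length_scale, length_actList, hlen, mul_one, true_and]
      exact allHPoint_iff.2 fun y hy => allHPoint_iff.1 (ih hall) y (mem_scale.1 hy).2
  | whyNot μ ih =>
      intro hall
      simp only [act, IsHPoint]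
      exact allHPoint_iff.2 fun y hy => allHPoint_iff.1 (ih hall) y (mem_of_mem_bump hy)
  | nil => simp [actList, AllHPoint]
  | cons x μ hx hμ =>
      rename_i hxμ
      simp only [actList, AllHPoint] at hxμ ⊢
      exact ⟨hx hxμ.1, hμ hxμ.2⟩

/-! ### Lemma 2: the action on `?`-trees -/

/-- The relabelling of a `?`-tree size performed by the `t`-action with factor `h`:
`n ↦ h·n` if `n > t`, `n ↦ n` if `n ≤ t`. [cite: LaurentTortoraDeFalco2006, Lemma 2] -/
def bumpSize (t h n : ℕ) : ℕ := if t < n then h * n else n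

/-- `qtreeList` does not see the multiplicities introduced by `bump` (positive factor).
[cite: LaurentTortoraDeFalco2006, App. D] -/
theorem qtreeList_bump {t k : ℕ} (hk : k ≠ 0) (l : List PrePoint) :
    qtreeList (bump t k l) = qtreeList l := by
  ext n
  simp only [mem_qtreeList, mem_bump hk]

/-- **Lemma 2** (action on `?`-trees): for `h > 0`,
`T((x)ₜ⁽ʰ⁾) = {h·n | n ∈ T(x), n > t} ∪ {n | n ∈ T(x), n ≤ t}`.
[cite: LaurentTortoraDeFalco2006, Lemma 2] -/
theorem qtree_act {t h : ℕ} (hh : h ≠ 0) (x : PrePoint) :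
    qtree (act t h x) = (qtree x).image (bumpSize t h) := by
  induction x using PrePoint.rec
    (motive_2 := fun μ => qtreeList (actList t h μ) = (qtreeList μ).image (bumpSize t h)) with
  | one => simp [act, qtree]
  | bot => simp [act, qtree]
  | tensor x y hx hy => simp [act, qtree, hx, hy, Finset.image_union]
  | par x y hx hy => simp [act, qtree, hx, hy, Finset.image_union]
  | ofCourse μ ih =>
      simp only [act, qtree]
      rw [qtreeList_bump hh, ih]
  | whyNot μ ih =>
      simp only [act, qtree]
      rw [qtreeList_bump hh, ih, Finset.image_insert, length_bump, length_actList]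
      congr 1
      simp only [bumpSize]
      split_ifs <;> first | rfl | omega
  | nil => simp [actList, qtreeList]
  | cons x μ hx hμ => simp [actList, qtreeList, hx, hμ, Finset.image_union]

/-- Lemma 2 in the paper's set-builder form. [cite: LaurentTortoraDeFalco2006, Lemma 2] -/
theorem mem_qtree_act_iff {t h : ℕ} (hh : h ≠ 0) {x : PrePoint} {m : ℕ} :
    m ∈ qtree (act t h x) ↔ (∃ n ∈ qtree x, t < n ∧ m = h * n) ∨ (m ∈ qtree x ∧ m ≤ t) := by
  rw [qtree_act hh, Finset.mem_image]
  constructor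
  · rintro ⟨n, hn, rfl⟩
    unfold bumpSize
    split_ifs with hlt
    · exact Or.inl ⟨n, hn, hlt, rfl⟩
    · exact Or.inr ⟨hn, Nat.not_lt.1 hlt⟩
  · rintro (⟨n, hn, hlt, rfl⟩ | ⟨hm, hle⟩)
    · exact ⟨n, hn, by simp [bumpSize, hlt]⟩
    · exact ⟨m, hm, by simp [bumpSize, Nat.not_lt.2 hle]⟩

/-- First arithmetic consequence used in the proof of Thm. 4: after the `0`-action with factor `h`,
all `?`-tree sizes are multiples of `h`. [cite: LaurentTortoraDeFalco2006, Thm. 4 (proof)] -/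
theorem dvd_of_mem_qtree_act_zero {h n : ℕ} (hh : h ≠ 0) {x : PrePoint}
    (hn : n ∈ qtree (act 0 h x)) : h ∣ n := by
  rw [qtree_act hh, Finset.mem_image] at hn
  obtain ⟨m, -, rfl⟩ := hn
  unfold bumpSize
  split_ifs with hm
  · exact Dvd.intro m rfl
  · obtain rfl : m = 0 := by omega
    exact dvd_zero h

/-- Second arithmetic consequence used in the proof of Thm. 4: if the `?`-tree sizes of `x` are
bounded by `B`, those of `(x)ₜ⁽ʰ⁾` are bounded by `h · B`.
[cite: LaurentTortoraDeFalco2006, Thm. 4 (proof)] -/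
theorem le_of_mem_qtree_act {t h B n : ℕ} (hh : h ≠ 0) {x : PrePoint} (hB : ∀ m ∈ qtree x, m ≤ B)
    (hn : n ∈ qtree (act t h x)) : n ≤ h * B := by
  rw [qtree_act hh, Finset.mem_image] at hn
  obtain ⟨m, hm, rfl⟩ := hn
  unfold bumpSize
  split_ifs
  · exact Nat.mul_le_mul_left h (hB m hm)
  · exact le_trans (hB m hm) (Nat.le_mul_of_pos_left B (Nat.pos_of_ne_zero hh))

end PrePoint

/-! ### The space `D` of points -/

/-- The untyped relational space `D`: points `x ::= 1 | ⊥ | x ⊗ x | x ⅋ x | !μ | ?μ` with `μ` a finite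
MULTISET of points, realised as the quotient of `PrePoint` by equality of nested multisets. Cliques
are subsets of `D` (`Set Point`). [cite: LaurentTortoraDeFalco2006, §5.1] -/
def Point : Type := Quotient PrePoint.instSetoid

namespace Point

/-- The point presented by a pre-point. [cite: LaurentTortoraDeFalco2006, §5.1] -/
def mk (x : PrePoint) : Point := Quotient.mk _ x

/-- Induction on points through presentations. [cite: LaurentTortoraDeFalco2006, §5.1] -/
@[elab_as_elim]
protected theorem ind {P : Point → Prop} (h : ∀ x, P (mk x)) (p : Point) : P p :=
  Quotient.ind h p

/-- `mk` is surjective. [cite: LaurentTortoraDeFalco2006, §5.1] -/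
theorem mk_surjective : Function.Surjective mk := fun p => Point.ind (fun x => ⟨x, rfl⟩) p

/-- Two presentations give the same point iff they are identified. [cite: LaurentTortoraDeFalco2006, §5.1] -/
theorem mk_eq_mk {x y : PrePoint} : mk x = mk y ↔ x ≈ y := Quotient.eq

/-- Equality of points is decidable (through the canonical codes). [cite: LaurentTortoraDeFalco2006, §5.1] -/
instance instDecidableEq : DecidableEq Point :=
  inferInstanceAs (DecidableEq (Quotient PrePoint.instSetoid))

/-- The canonical code of a point. [cite: LaurentTortoraDeFalco2006, §5.1] -/
def code : Point → ℕ := Quotient.lift PrePoint.code fun _ _ h => h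

/-- The code of a presented point. [cite: LaurentTortoraDeFalco2006, §5.1] -/
@[simp] theorem code_mk (x : PrePoint) : code (mk x) = x.code := rfl

/-- Points are determined by their codes. [cite: LaurentTortoraDeFalco2006, §5.1] -/
theorem code_injective : Function.Injective code := by
  intro p q
  induction p using Point.ind with
  | h x =>
    induction q using Point.ind with
    | h y => exact fun h => mk_eq_mk.2 h

/-- `D` is countable. [cite: LaurentTortoraDeFalco2006, §5.1] -/
instance instCountable : Countable Point := code_injective.countable

/-- The point `1`. [cite: LaurentTortoraDeFalco2006, §5.1] -/
protected def one : Point := mk .one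

/-- The point `⊥`. [cite: LaurentTortoraDeFalco2006, §5.1] -/
protected def bot : Point := mk .bot

/-- `x ⊗ y` on points. [cite: LaurentTortoraDeFalco2006, §5.1] -/
def tensor : Point → Point → Point :=
  Quotient.map₂ PrePoint.tensor fun _ _ h₁ _ _ h₂ => PrePoint.tensor_congr h₁ h₂

/-- `x ⅋ y` on points. [cite: LaurentTortoraDeFalco2006, §5.1] -/
def par : Point → Point → Point :=
  Quotient.map₂ PrePoint.par fun _ _ h₁ _ _ h₂ => PrePoint.par_congr h₁ h₂

/-- `!μ` for a finite multiset `μ` of points (defined through representatives, hence noncomputable;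
its computation rule is `mk_ofCourse`, its injectivity `ofCourse_injective`).
[cite: LaurentTortoraDeFalco2006, §5.1] -/
noncomputable def ofCourse (m : Multiset Point) : Point :=
  mk (.ofCourse ((m.map Quotient.out).toList))

/-- `?μ` for a finite multiset `μ` of points (through representatives; computation rule `mk_whyNot`,
injectivity `whyNot_injective`). [cite: LaurentTortoraDeFalco2006, §5.1] -/
noncomputable def whyNot (m : Multiset Point) : Point :=
  mk (.whyNot ((m.map Quotient.out).toList))

/-- `mk` on `1`. [cite: LaurentTortoraDeFalco2006, §5.1] -/
theorem mk_one : mk .one = Point.one := rfl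

/-- `mk` on `⊥`. [cite: LaurentTortoraDeFalco2006, §5.1] -/
theorem mk_bot : mk .bot = Point.bot := rfl

/-- `⊗` of presented points. [cite: LaurentTortoraDeFalco2006, §5.1] -/
@[simp] theorem tensor_mk (x y : PrePoint) : tensor (mk x) (mk y) = mk (.tensor x y) := rfl

/-- `⅋` of presented points. [cite: LaurentTortoraDeFalco2006, §5.1] -/
@[simp] theorem par_mk (x y : PrePoint) : par (mk x) (mk y) = mk (.par x y) := rfl

/-- `1 ≠ ⊥` in `D`. [cite: LaurentTortoraDeFalco2006, §5.1] -/
theorem one_ne_bot : Point.one ≠ Point.bot := fun h => by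
  simpa using PrePoint.one_equiv_iff.1 (mk_eq_mk.1 h)

/-- Two `!`-points coincide iff their multisets of entries coincide as multisets of POINTS: the
identification is exactly equality of nested finite multisets. [cite: LaurentTortoraDeFalco2006, §5.1] -/
theorem mk_ofCourse_eq_mk_ofCourse_iff {μ ν : List PrePoint} :
    mk (.ofCourse μ) = mk (.ofCourse ν) ↔ (μ.map mk : Multiset Point) = (ν.map mk : Multiset Point) := by
  rw [mk_eq_mk, PrePoint.ofCourse_equiv_iff]
  constructor
  · rintro ⟨ν', hν, hp⟩
    cases hν
    rw [Multiset.coe_eq_coe]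
    exact PrePoint.perm_map_of_perm_map hp fun a _ b _ hab => mk_eq_mk.2 hab
  · intro h
    refine ⟨ν, rfl, ?_⟩
    rw [Multiset.coe_eq_coe] at h
    exact PrePoint.perm_map_of_perm_map h fun a _ b _ hab => mk_eq_mk.1 hab

/-- Two `?`-points coincide iff their multisets of entries coincide as multisets of points.
[cite: LaurentTortoraDeFalco2006, §5.1] -/
theorem mk_whyNot_eq_mk_whyNot_iff {μ ν : List PrePoint} :
    mk (.whyNot μ) = mk (.whyNot ν) ↔ (μ.map mk : Multiset Point) = (ν.map mk : Multiset Point) := by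
  rw [mk_eq_mk, PrePoint.whyNot_equiv_iff]
  constructor
  · rintro ⟨ν', hν, hp⟩
    cases hν
    rw [Multiset.coe_eq_coe]
    exact PrePoint.perm_map_of_perm_map hp fun a _ b _ hab => mk_eq_mk.2 hab
  · intro h
    refine ⟨ν, rfl, ?_⟩
    rw [Multiset.coe_eq_coe] at h
    exact PrePoint.perm_map_of_perm_map h fun a _ b _ hab => mk_eq_mk.1 hab

/-- The entries of `(m.map out).toList`, read back in `D`, are `m`. [cite: LaurentTortoraDeFalco2006, §5.1] -/
theorem coe_map_mk_toList_out (m : Multiset Point) :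
    (((m.map Quotient.out).toList.map mk : List Point) : Multiset Point) = m := by
  rw [← Multiset.map_coe, Multiset.coe_toList, Multiset.map_map]
  conv_rhs => rw [← Multiset.map_id m]
  refine Multiset.map_congr rfl fun p _ => ?_
  exact Quotient.out_eq p

/-- `mk (![x₁,…,xₙ]) = !{mk x₁,…,mk xₙ}`. [cite: LaurentTortoraDeFalco2006, §5.1] -/
theorem mk_ofCourse (μ : List PrePoint) : mk (.ofCourse μ) = ofCourse (μ.map mk : List Point) := by
  unfold ofCourse
  rw [mk_ofCourse_eq_mk_ofCourse_iff, coe_map_mk_toList_out]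

/-- `mk (?[x₁,…,xₙ]) = ?{mk x₁,…,mk xₙ}`. [cite: LaurentTortoraDeFalco2006, §5.1] -/
theorem mk_whyNot (μ : List PrePoint) : mk (.whyNot μ) = whyNot (μ.map mk : List Point) := by
  unfold whyNot
  rw [mk_whyNot_eq_mk_whyNot_iff, coe_map_mk_toList_out]

/-- `!` is injective on multisets of points. [cite: LaurentTortoraDeFalco2006, §5.1] -/
theorem ofCourse_injective : Function.Injective ofCourse := by
  intro m m' h
  unfold ofCourse at h
  rw [mk_ofCourse_eq_mk_ofCourse_iff, coe_map_mk_toList_out, coe_map_mk_toList_out] at h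
  exact h

/-- `?` is injective on multisets of points. [cite: LaurentTortoraDeFalco2006, §5.1] -/
theorem whyNot_injective : Function.Injective whyNot := by
  intro m m' h
  unfold whyNot at h
  rw [mk_whyNot_eq_mk_whyNot_iff, coe_map_mk_toList_out, coe_map_mk_toList_out] at h
  exact h

/-- `?{p} = mk (?[y])` for a presentation `y` of `p`. [cite: LaurentTortoraDeFalco2006, §5.1] -/
theorem whyNot_singleton_mk (y : PrePoint) : whyNot {mk y} = mk (.whyNot [y]) := by
  rw [mk_whyNot]
  rfl

/-- The duality `x ↦ x̄` on `D`. [cite: LaurentTortoraDeFalco2006, §5.1] -/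
def dual : Point → Point := Quotient.map PrePoint.dual fun _ _ h => PrePoint.dual_congr h

/-- Duality on a presented point. [cite: LaurentTortoraDeFalco2006, §5.1] -/
@[simp] theorem dual_mk (x : PrePoint) : dual (mk x) = mk x.dual := rfl

/-- Duality is an involution of `D`. [cite: LaurentTortoraDeFalco2006, §5.1] -/
theorem dual_dual (p : Point) : dual (dual p) = p := by
  induction p using Point.ind with
  | h x => rw [dual_mk, dual_mk, PrePoint.dual_dual]

/-- The `t`-action `(k, x) ↦ (x)ₜ⁽ᵏ⁾` of Def. 13 on `D`. [cite: LaurentTortoraDeFalco2006, Def. 13] -/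
def act (t k : ℕ) : Point → Point := Quotient.map (PrePoint.act t k) fun _ _ h => PrePoint.act_congr t k h

/-- The action on a presented point. [cite: LaurentTortoraDeFalco2006, Def. 13] -/
@[simp] theorem act_mk (t k : ℕ) (x : PrePoint) : act t k (mk x) = mk (x.act t k) := rfl

/-- Def. 1, first law: `(x)ₜ⁽¹⁾ = x` — `D` with the `t`-action is an `ℕ`-set.
[cite: LaurentTortoraDeFalco2006, Def. 1] -/
theorem act_one (t : ℕ) (p : Point) : act t 1 p = p := by
  induction p using Point.ind with
  | h x => rw [act_mk, PrePoint.act_one]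

/-- Def. 1, second law: `(x)ₜ⁽ᵏᵏ'⁾ = ((x)ₜ⁽ᵏ⁾)ₜ⁽ᵏ'⁾`. [cite: LaurentTortoraDeFalco2006, Def. 1] -/
theorem act_mul (t k k' : ℕ) (p : Point) : act t (k * k') p = act t k' (act t k p) := by
  induction p using Point.ind with
  | h x => rw [act_mk, act_mk, act_mk, PrePoint.act_mul]

/-- The actions for different factors commute. [cite: LaurentTortoraDeFalco2006, Def. 1] -/
theorem act_comm (t k k' : ℕ) (p : Point) : act t k' (act t k p) = act t k (act t k' p) := by
  rw [← act_mul, mul_comm, act_mul]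

/-- The action commutes with duality. [cite: LaurentTortoraDeFalco2006, Def. 13] -/
theorem dual_act (t k : ℕ) (p : Point) : dual (act t k p) = act t k (dual p) := by
  induction p using Point.ind with
  | h x => rw [act_mk, dual_mk, dual_mk, act_mk, PrePoint.dual_act]

end Point

/-! ### Obsessional cliques -/

/-- A clique `c ⊆ D` is `t`-OBSESSIONAL if it is closed under the `t`-action of `ℕ*`:
`∀ x ∈ c, ∀ k ≥ 1, (x)ₜ⁽ᵏ⁾ ∈ c` (Def. 3 for the `ℕ`-set `Dₜ`, Def. 13).
[cite: LaurentTortoraDeFalco2006, Def. 13] -/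
def IsObsessional (t : ℕ) (c : Set Point) : Prop :=
  ∀ ⦃x : Point⦄, x ∈ c → ∀ ⦃k : ℕ⦄, 0 < k → x.act t k ∈ c

/-- A clique is OBSESSIONAL FROM `t` if it is `t'`-obsessional for every `t' ≥ t` (Def. 13); "obsessional
from some `t`" is the morphism condition of the model `SREL` of `SLL` (Def. 4, Prop. 8).
[cite: LaurentTortoraDeFalco2006, Def. 13] -/
def ObsessionalFrom (t : ℕ) (c : Set Point) : Prop :=
  ∀ ⦃t' : ℕ⦄, t ≤ t' → IsObsessional t' c

/-- The `t`-obsessional cliques of `D` as a type (Def. 3: "a clique `c` is obsessional if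
`∀ a ∈ c, ∀ k ∈ ℕ*, a⁽ᵏ⁾ ∈ c`", for the `ℕ`-set `Dₜ`). [cite: LaurentTortoraDeFalco2006, Def. 3] -/
def ObsessionalClique (t : ℕ) : Type := {c : Set Point // IsObsessional t c}

namespace ObsessionalClique

/-- The underlying clique. [cite: LaurentTortoraDeFalco2006, Def. 3] -/
instance instSetLike (t : ℕ) : SetLike (ObsessionalClique t) Point where
  coe c := c.1
  coe_injective _ _ h := Subtype.ext h

/-- An obsessional clique is obsessional. [cite: LaurentTortoraDeFalco2006, Def. 3] -/
theorem isObsessional {t : ℕ} (c : ObsessionalClique t) : IsObsessional t (c : Set Point) := c.2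

/-- Extensionality. [cite: LaurentTortoraDeFalco2006, Def. 3] -/
@[ext] theorem ext {t : ℕ} {c d : ObsessionalClique t} (h : ∀ x, x ∈ c ↔ x ∈ d) : c = d :=
  SetLike.ext h

end ObsessionalClique

section API

variable {t : ℕ} {c d : Set Point}

/-- Reformulation: `c` is `t`-obsessional iff it contains its images under the actions.
[cite: LaurentTortoraDeFalco2006, Def. 13] -/
theorem isObsessional_iff_image_subset :
    IsObsessional t c ↔ ∀ k, 0 < k → Point.act t k '' c ⊆ c := by
  constructor
  · rintro h k hk _ ⟨x, hx, rfl⟩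
    exact h hx hk
  · intro h x hx k hk
    exact h k hk ⟨x, hx, rfl⟩

/-- The empty clique is obsessional. [cite: LaurentTortoraDeFalco2006, Def. 13] -/
theorem isObsessional_empty : IsObsessional t (∅ : Set Point) := fun _ h => h.elim

/-- The full clique is obsessional. [cite: LaurentTortoraDeFalco2006, Def. 13] -/
theorem isObsessional_univ : IsObsessional t (Set.univ : Set Point) := fun _ _ _ _ => trivial

/-- Obsessional cliques are closed under intersection. [cite: LaurentTortoraDeFalco2006, Def. 13] -/
theorem IsObsessional.inter (hc : IsObsessional t c) (hd : IsObsessional t d) :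
    IsObsessional t (c ∩ d) := fun _ hx _ hk => ⟨hc hx.1 hk, hd hx.2 hk⟩

/-- Obsessional cliques are closed under union. [cite: LaurentTortoraDeFalco2006, Def. 13] -/
theorem IsObsessional.union (hc : IsObsessional t c) (hd : IsObsessional t d) :
    IsObsessional t (c ∪ d) := fun _ hx _ hk => hx.elim (fun h => Or.inl (hc h hk)) fun h => Or.inr (hd h hk)

/-- Obsessional cliques are closed under arbitrary unions. [cite: LaurentTortoraDeFalco2006, Def. 13] -/
theorem isObsessional_sUnion {S : Set (Set Point)} (h : ∀ c ∈ S, IsObsessional t c) :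
    IsObsessional t (⋃₀ S) := by
  rintro x ⟨c, hc, hx⟩ k hk
  exact ⟨c, hc, h c hc hx hk⟩

/-- Obsessional cliques are closed under arbitrary intersections. [cite: LaurentTortoraDeFalco2006, Def. 13] -/
theorem isObsessional_sInter {S : Set (Set Point)} (h : ∀ c ∈ S, IsObsessional t c) :
    IsObsessional t (⋂₀ S) := fun _ hx _ hk c hc => h c hc (hx c hc) hk

/-- "Obsessional from" is monotone in the threshold. [cite: LaurentTortoraDeFalco2006, Def. 13] -/
theorem ObsessionalFrom.mono {t t' : ℕ} (h : t ≤ t') (hc : ObsessionalFrom t c) : ObsessionalFrom t' c :=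
  fun _ ht => hc (le_trans h ht)

/-- "Obsessional from `t`" gives `t`-obsessional. [cite: LaurentTortoraDeFalco2006, Def. 13] -/
theorem ObsessionalFrom.isObsessional (hc : ObsessionalFrom t c) : IsObsessional t c := hc le_rfl

/-- The `t`-obsessional hull of a clique: its orbit under the `t`-action of `ℕ*` — by the monoid law
this orbit is already closed, so it is the least `t`-obsessional clique containing `c`.
[cite: LaurentTortoraDeFalco2006, Def. 13] -/
def obsessionalHull (t : ℕ) (c : Set Point) : Set Point :=
  {y | ∃ x ∈ c, ∃ k : ℕ, 0 < k ∧ x.act t k = y}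

/-- A clique is contained in its hull. [cite: LaurentTortoraDeFalco2006, Def. 13] -/
theorem subset_obsessionalHull : c ⊆ obsessionalHull t c :=
  fun x hx => ⟨x, hx, 1, Nat.one_pos, Point.act_one t x⟩

/-- The hull is obsessional (this is where the monoid law of Def. 1 is used).
[cite: LaurentTortoraDeFalco2006, Def. 13] -/
theorem isObsessional_obsessionalHull : IsObsessional t (obsessionalHull t c) := by
  rintro _ ⟨x, hx, k, hk, rfl⟩ k' hk'
  exact ⟨x, hx, k * k', Nat.mul_pos hk hk', Point.act_mul t k k' x⟩

/-- The hull is the least obsessional clique containing `c`. [cite: LaurentTortoraDeFalco2006, Def. 13] -/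
theorem obsessionalHull_subset (hcd : c ⊆ d) (hd : IsObsessional t d) : obsessionalHull t c ⊆ d := by
  rintro _ ⟨x, hx, k, hk, rfl⟩
  exact hd (hcd hx) hk

/-- A clique is obsessional iff it contains (equivalently, equals) its hull.
[cite: LaurentTortoraDeFalco2006, Def. 13] -/
theorem isObsessional_iff_obsessionalHull_subset : IsObsessional t c ↔ obsessionalHull t c ⊆ c :=
  ⟨fun h => obsessionalHull_subset subset_rfl h,
    fun h _ hx _ hk => h ⟨_, hx, _, hk, rfl⟩⟩

/-- A clique of exponential-free (`MLL`) points is `t`-obsessional for every `t` ("for MLL … any clique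
is obsessional", §5.3). [cite: LaurentTortoraDeFalco2006, §5.3] -/
theorem isObsessional_of_isExpFree
    (h : ∀ p ∈ c, ∃ x : PrePoint, Point.mk x = p ∧ x.IsExpFree) : IsObsessional t c := by
  intro p hp k _
  obtain ⟨x, rfl, hx⟩ := h p hp
  rwa [Point.act_mk, PrePoint.act_eq_self_of_isExpFree t k hx]

end API

/-! ### The dereliction clique: obsessional exactly for `t ≥ 1` (untyped form of a remark of §2.2) -/

/-- The interpretation of dereliction, untyped: the clique `{?[x̄] ⅋ x | x ∈ D}` (the results of the
experiments of the net made of one axiom link and one `?d`-node). §2.2 remarks (typed setting) that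
"dereliction is not obsessional in `!₀A × A`". [cite: LaurentTortoraDeFalco2006, §2.2] -/
def derelictionClique : Set Point :=
  Set.range fun p : Point => (Point.whyNot {p.dual}).par p

/-- For `t ≥ 1` the dereliction clique IS `t`-obsessional (singleton multisets are below the
threshold). [cite: LaurentTortoraDeFalco2006, §2.2] -/
theorem isObsessional_succ_derelictionClique (t : ℕ) : IsObsessional (t + 1) derelictionClique := by
  rintro _ ⟨p, rfl⟩ k _
  induction p using Point.ind with
  | h x =>
    refine ⟨Point.mk (x.act (t + 1) k), ?_⟩
    dsimp only
    rw [Point.dual_mk, Point.dual_mk, Point.whyNot_singleton_mk, Point.whyNot_singleton_mk,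
      Point.par_mk, Point.par_mk, Point.act_mk, PrePoint.dual_act]
    congr 1

/-- For `t = 0` the dereliction clique is NOT `0`-obsessional: `(?[⊥] ⅋ 1)₀⁽²⁾ = ?[⊥, ⊥] ⅋ 1` is not of
the form `?[x̄] ⅋ x`. [cite: LaurentTortoraDeFalco2006, §2.2] -/
theorem not_isObsessional_zero_derelictionClique : ¬ IsObsessional 0 derelictionClique := by
  intro h
  have hmem : (Point.whyNot {Point.one.dual}).par Point.one ∈ derelictionClique := ⟨Point.one, rfl⟩
  obtain ⟨q, hq⟩ := h hmem Nat.two_pos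
  dsimp only at hq
  induction q using Point.ind with
  | h y =>
    have h2 : Point.act 0 2 (Point.mk (.par (.whyNot [.bot]) .one)) =
        Point.mk (.par (.whyNot [.bot, .bot]) .one) := by
      rw [Point.act_mk]
      rfl
    rw [← Point.mk_one, Point.dual_mk, Point.dual_mk, Point.whyNot_singleton_mk,
      Point.whyNot_singleton_mk, Point.par_mk, Point.par_mk] at hq
    simp only [PrePoint.dual] at hq
    rw [h2, Point.mk_eq_mk, PrePoint.par_equiv_iff] at hq
    obtain ⟨y₁, y₂, hy, e₁, -⟩ := hq
    cases hy
    obtain ⟨ν, hν, hp⟩ := PrePoint.whyNot_equiv_iff.1 e₁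
    cases hν
    simpa using hp.length_eq

end Literature.Computability.ImplicitComplexity.URel
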